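import Summits.HodgeConjecture.CorCM.Census.CyclicCharacterFlipOrbit

/-!
# Cyclic characters, XIV: THE FIBRE WALK — local linearisation, the fibre sum and the top flips of the arc type

COR-CM (cell `pub-hodgecm2`), count-neutral kernel combinatorics by the binder seat b09 (gen 42; lane CYCLIC-CHARACTER FIBRE LAW, part XIV), on the prior
programmeʼs deviation-set induction (`CorCM/Prior/AllgGroup2.lean`: `single_sub_thetaG_mem`, here LOCALISED), part XII (`Census/CyclicCharacterFlipOrbit.lean`)
and gen 38/41ʼs arc-type API BY NAME.  Theorems only (no definition, no `decide`, no certificate, no named fact, no `sorry`).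
HONEST FRAMING: `HC_CM` is NOT proved, here or anywhere in the tree; nothing here is a period or a headline.

THE WALK.  Flipping the arc type `T_0 = w⁻¹[0, 2ᵏ⁻¹)` at the places of its BOTTOM FIBRE `F_0 = w⁻¹(0)` one by one walks from `T_0` to the next arc type
`T_1 = w⁻¹[1, 2ᵏ⁻¹]` (`sdiff_arcType_one`: the deviation set of `T_1` from `T_0` is exactly `F_0`).  The `2^{|F_0|}` intermediate types form a Boolean
lattice on which the face relations are the second differences, so every walk type is LINEARISED by the walk faces:

* §1 **LOCAL LINEARISATION** (`single_sub_thetaG_mem_span_local`, any `(G, c)`, any base type `T`, any place set `D`): for a type `Φ` deviating from `T`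
  inside `D`, `[Φ] − ([T] + Σ_{t ∈ T∖Φ} ([T^{(t)}] − [T]))` lies in the `ℤ`-span of the faces `gface Φ' s s'` AT TYPES `Φ'` DEVIATING INSIDE `D`, at two
  deviation places — the prior programmeʼs induction run with this book-keeping (its global form is `RfwfAllgGroup.single_sub_thetaG_mem`).
* §2 **THE TWO WALK RELATIONS of the arc type** modulo the span of the BOTTOM-WALK FACES (faces at types deviating from `T_0` inside `F_0`):
  (W2) `Σ_{s ∈ F_0} [T_0^{(s)}] ≡ [T_1] + (|F_0| − 1)·[T_0]` (`fibreSum_sub_mem_span_walkFaces`) — the FIBRE SUM IS AN ARC COMBINATION;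
  (W1) `[T_1^{(t)}] ≡ [T_0] + Σ_{s ∈ F_0 ∖ t} ([T_0^{(s)}] − [T_0])` for `t ∈ F_0` (`single_oflipCM_arcType_one_sub_mem_span_walkFaces`) — the TOP FLIPS of
  `T_1` are combinations of the BOTTOM FLIPS of `T_0` and arc types.
* §3 **CONSEQUENCES FOR THE REPAIRED HYPOTHESES of part XII/XIII**: if `ℤ⟨pairs⟩ + ℤ[G]·S` contains the bottom-walk faces, then (fib) holds with exponent
  `0` (`fibreSum_mem_of_walkFaces_le`) and every TOP flip of `T_0` (`w s = 2ᵏ⁻¹ − 1`) satisfies (flip′) with exponent `0`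
  (`single_oflipCM_top_mem_flipTarget_of_walkFaces_le`); the bottom flips satisfy it trivially (part XII).  For `k = 2` these are ALL positions —
  part XV (`Census/CyclicCharacterQuarticMeta.lean`) turns this into the QUARTIC META THEOREMS.

## References
* [Pohlmann1968] H. Pohlmann, Algebraic cycles on abelian varieties of complex multiplication type, Ann. of Math. 88 (1968), Thm 1.
* [Milne1999] J. S. Milne, Lefschetz motives and the Tate conjecture, Compositio Math. 117 (1999), Prop. 2.1, p. 54.
-/

namespace Summit.HodgeConjecture.CorCM.Census.CyclicCharacter

open Finset
open Summit.HodgeConjecture.CorCM.Prior.AllgGroup.RfwfAllgGroup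
open Summit.HodgeConjecture.CorCM.Census.BlockParity
open Summit.HodgeConjecture.CorCM.Census.Coinvariant
open Summit.HodgeConjecture.CorCM.Census.TwistGeneration
open Summit.HodgeConjecture.CorCM.Census.Nondegenerate
open Summit.HodgeConjecture.CorCM.Census.BaseBlock

noncomputable section

variable {G : Type*} [Group G] [Fintype G] [DecidableEq G] {k : ℕ} {w : G → ZMod (2 ^ k)} {c : G}

/-! ## §1 Local linearisation -/

/-- **The normal form `θ(1_Φ) = [T] + Σ_{t ∈ T∖Φ} ([T^{(t)}] − [T])`** of the prior programmeʼs section `thetaG`. [folklore] -/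
theorem thetaG_typeSum_single (hc2 : c * c = 1) (T Φ : CMF G c) :
    thetaG c hc2 T (typeSum G c (Finsupp.single Φ (1 : ℤ))) =
      (∑ t ∈ T.1 \ Φ.1, (Finsupp.single (oflipCM c hc2 t T) (1 : ℤ) - Finsupp.single T 1)) + Finsupp.single T 1 := by
  rw [typeSum_single, thetaG_apply, indG_pair c Φ 1, one_smul, sdiff_eq_filter, Finset.sum_filter]
  congr 1
  refine Finset.sum_congr rfl fun t _ => ?_
  unfold indG
  by_cases ht : t ∈ Φ.1
  · rw [if_neg ((Φ.2 t).mp ht), zero_smul, if_neg (not_not.mpr ht)]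
  · rw [if_pos (by by_contra h; exact ht ((Φ.2 t).mpr h)), one_smul, if_pos ht]

/-- **LOCAL LINEARISATION.**  For every base type `T`, place set `D` and type `Φ` deviating from `T` inside `D`:
`[Φ] − θ(1_Φ)` lies in the `ℤ`-span of the faces `gface Φ' s s'` at types `Φ'` deviating from `T` inside `D`, at two distinct deviation places `s ≠ s'`
— the induction of `RfwfAllgGroup.single_sub_thetaG_mem`, localised. [folklore] -/
theorem single_sub_thetaG_mem_span_local (hc2 : c * c = 1) (T : CMF G c) (D : Finset G) :
    ∀ (n : ℕ) (Φ : CMF G c), (T.1 \ Φ.1).card = n → T.1 \ Φ.1 ⊆ D →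
      Finsupp.single Φ (1 : ℤ) - thetaG c hc2 T (typeSum G c (Finsupp.single Φ 1)) ∈
        Submodule.span ℤ {y : CMF G c →₀ ℤ | ∃ (Φ' : CMF G c) (s s' : G),
          T.1 \ Φ'.1 ⊆ D ∧ s ∈ T.1 \ Φ'.1 ∧ s' ∈ T.1 \ Φ'.1 ∧ s ≠ s' ∧ y = gface c hc2 Φ' s s'} := by
  intro n
  induction n using Nat.strong_induction_on with
  | h n ih =>
  intro Φ hn hD
  rcases n with _ | (_ | m)
  · have hΦ : Φ = T := eq_of_dev_empty c (Finset.card_eq_zero.mp hn)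
    rw [hΦ, thetaG_typeSum_single, sdiff_self, Finset.bot_eq_empty, Finset.sum_empty, zero_add, sub_self]
    exact Submodule.zero_mem _
  · obtain ⟨s, hs⟩ := Finset.card_eq_one.mp hn
    have hmem : s ∈ T.1 \ Φ.1 := hs ▸ Finset.mem_singleton_self s
    have hsT : s ∈ T.1 := (Finset.mem_sdiff.mp hmem).1
    have hd : Φ = oflipCM c hc2 s T := eq_oflip_of_dev_singleton c hc2 hs
    rw [thetaG_typeSum_single, hs, Finset.sum_singleton, hd, sub_add_cancel, sub_self]
    exact Submodule.zero_mem _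
  · have h2 : 1 < (T.1 \ Φ.1).card := by omega
    obtain ⟨s, hsD, s', hs'D, hss'⟩ := Finset.one_lt_card.mp h2
    have hsT : s ∈ T.1 := (Finset.mem_sdiff.mp hsD).1
    have hsΦ : s ∉ Φ.1 := (Finset.mem_sdiff.mp hsD).2
    have hs'T : s' ∈ T.1 := (Finset.mem_sdiff.mp hs'D).1
    have hs'Φ : s' ∉ Φ.1 := (Finset.mem_sdiff.mp hs'D).2
    have hs'O : s' ∉ orb c s := by
      rw [mem_orb]
      rintro (h1 | h1)
      · exact hss' h1.symm
      · exact ((T.2 s).mp hsT) (h1 ▸ hs'T)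
    have hdev1 : (T.1 \ (oflipCM c hc2 s Φ).1).card = m + 1 := by
      rw [dev_oflip c hc2 hsT hsΦ, Finset.card_erase_of_mem hsD]
      omega
    have hdev2 : (T.1 \ (oflipCM c hc2 s' Φ).1).card = m + 1 := by
      rw [dev_oflip c hc2 hs'T hs'Φ, Finset.card_erase_of_mem hs'D]
      omega
    have hsflip : s ∉ (oflipCM c hc2 s' Φ).1 := by
      show s ∉ oflip c s' Φ.1
      have hsO' : s ∉ orb c s' := by
        rw [mem_orb]
        rintro (h1 | h1)
        · exact hss' h1
        · exact ((T.2 s').mp hs'T) (h1 ▸ hsT)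
      intro hmem
      rw [oflip, Finset.mem_symmDiff] at hmem
      rcases hmem with ⟨h1, -⟩ | ⟨h1, -⟩
      · exact hsΦ h1
      · exact hsO' h1
    have hdev3 : (T.1 \ (oflipCM c hc2 s (oflipCM c hc2 s' Φ)).1).card = m := by
      rw [dev_oflip c hc2 hsT hsflip, dev_oflip c hc2 hs'T hs'Φ, Finset.card_erase_of_mem (Finset.mem_erase.mpr ⟨hss', hsD⟩),
        Finset.card_erase_of_mem hs'D]
      omega
    have hD1 : T.1 \ (oflipCM c hc2 s Φ).1 ⊆ D := by
      rw [dev_oflip c hc2 hsT hsΦ]; exact (Finset.erase_subset _ _).trans hD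
    have hD2 : T.1 \ (oflipCM c hc2 s' Φ).1 ⊆ D := by
      rw [dev_oflip c hc2 hs'T hs'Φ]; exact (Finset.erase_subset _ _).trans hD
    have hD3 : T.1 \ (oflipCM c hc2 s (oflipCM c hc2 s' Φ)).1 ⊆ D := by
      rw [dev_oflip c hc2 hsT hsflip, dev_oflip c hc2 hs'T hs'Φ]
      exact ((Finset.erase_subset _ _).trans (Finset.erase_subset _ _)).trans hD
    have hfacemem : gface c hc2 Φ s s' ∈ Submodule.span ℤ {y : CMF G c →₀ ℤ | ∃ (Φ' : CMF G c) (s s' : G),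
        T.1 \ Φ'.1 ⊆ D ∧ s ∈ T.1 \ Φ'.1 ∧ s' ∈ T.1 \ Φ'.1 ∧ s ≠ s' ∧ y = gface c hc2 Φ' s s'} :=
      Submodule.subset_span ⟨Φ, s, s', hD, hsD, hs'D, hss', rfl⟩
    have key : Finsupp.single Φ (1 : ℤ) - thetaG c hc2 T (typeSum G c (Finsupp.single Φ 1))
        = (gface c hc2 Φ s s'
            - thetaG c hc2 T (typeSum G c (gface c hc2 Φ s s')))
          + (Finsupp.single (oflipCM c hc2 s Φ) (1 : ℤ)
              - thetaG c hc2 T (typeSum G c (Finsupp.single (oflipCM c hc2 s Φ) 1)))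
          + (Finsupp.single (oflipCM c hc2 s' Φ) (1 : ℤ)
              - thetaG c hc2 T (typeSum G c (Finsupp.single (oflipCM c hc2 s' Φ) 1)))
          - (Finsupp.single (oflipCM c hc2 s (oflipCM c hc2 s' Φ)) (1 : ℤ)
              - thetaG c hc2 T (typeSum G c (Finsupp.single (oflipCM c hc2 s (oflipCM c hc2 s' Φ)) 1))) := by
      simp only [gface, map_add, map_sub]
      abel
    rw [key]
    refine Submodule.sub_mem _ (Submodule.add_mem _ (Submodule.add_mem _ ?_ ?_) ?_) ?_
    · rw [typeSum_gface c hc2 Φ hs'O, map_zero, sub_zero]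
      exact hfacemem
    · exact ih (m + 1) (by omega) _ hdev1 hD1
    · exact ih (m + 1) (by omega) _ hdev2 hD2
    · exact ih m (by omega) _ hdev3 hD3

/-- **LOCAL LINEARISATION, normal form**: `[Φ] − ([T] + Σ_{t ∈ T∖Φ} ([T^{(t)}] − [T])) ∈ ℤ⟨faces at types deviating inside D⟩` whenever `T ∖ Φ ⊆ D`. [folklore] -/
theorem single_sub_normalForm_mem_span_local (hc2 : c * c = 1) (T : CMF G c) (D : Finset G) (Φ : CMF G c) (hD : T.1 \ Φ.1 ⊆ D) :
    Finsupp.single Φ (1 : ℤ) - ((∑ t ∈ T.1 \ Φ.1, (Finsupp.single (oflipCM c hc2 t T) (1 : ℤ) - Finsupp.single T 1)) + Finsupp.single T 1) ∈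
      Submodule.span ℤ {y : CMF G c →₀ ℤ | ∃ (Φ' : CMF G c) (s s' : G),
        T.1 \ Φ'.1 ⊆ D ∧ s ∈ T.1 \ Φ'.1 ∧ s' ∈ T.1 \ Φ'.1 ∧ s ≠ s' ∧ y = gface c hc2 Φ' s s'} := by
  rw [← thetaG_typeSum_single hc2 T Φ]
  exact single_sub_thetaG_mem_span_local hc2 T D _ Φ rfl hD

/-! ## §2 The bottom walk of the arc type: `T_0 ∖ T_1 = F_0`, and the two walk relations -/

omit [Fintype G] [DecidableEq G] in
/-- In `ℤ/2ᵏ` (`k ≥ 1`): `u ∈ [0, 2ᵏ⁻¹)` and `u − 1 ∉ [0, 2ᵏ⁻¹)` iff `u = 0`. [folklore] -/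
theorem val_lt_half_and_not_iff (hk : 1 ≤ k) (u : ZMod (2 ^ k)) : (u.val < 2 ^ (k - 1) ∧ ¬ (u - 1).val < 2 ^ (k - 1)) ↔ u = 0 := by
  haveI : NeZero (2 ^ k) := ⟨pow_ne_zero _ two_ne_zero⟩
  haveI : Fact (1 < 2 ^ k) := ⟨Nat.one_lt_two_pow (by omega)⟩
  have h2k : 2 ^ k = 2 * 2 ^ (k - 1) := by rw [← pow_succ', Nat.sub_add_cancel hk]
  constructor
  · rintro ⟨hlt, hnot⟩
    by_contra hu
    have hu1 : 1 ≤ u.val := Nat.one_le_iff_ne_zero.mpr fun h => hu ((ZMod.val_eq_zero u).mp h)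
    have hv : (u - 1).val = u.val - 1 := by rw [ZMod.val_sub (by rw [ZMod.val_one]; exact hu1), ZMod.val_one]
    rw [hv] at hnot
    omega
  · rintro rfl
    refine ⟨by rw [ZMod.val_zero]; exact Nat.two_pow_pos _, ?_⟩
    rw [zero_sub, ZMod.neg_val, if_neg one_ne_zero, ZMod.val_one]
    have := Nat.one_le_two_pow (n := k - 1)
    omega

/-- **The deviation set of `T_1` from `T_0` is the bottom fibre**: `s ∈ T_0 ∖ T_1 ↔ w s = 0`. [folklore] -/
theorem mem_sdiff_arcType_one_iff (hw : ∀ P Q : G, w (P * Q) = w P + w Q) (hk : 1 ≤ k) (hc2 : c * c = 1) (hwc : w c ≠ 0) (s : G) :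
    s ∈ (arcType hw hk hc2 hwc 0).1 \ (arcType hw hk hc2 hwc 1).1 ↔ w s = 0 := by
  rw [mem_sdiff, mem_arcType, mem_arcType, sub_zero]
  exact val_lt_half_and_not_iff hk (w s)

/-- `T_0 ∖ T_1 = F_0 = {s | w s = 0}`. [folklore] -/
theorem sdiff_arcType_one (hw : ∀ P Q : G, w (P * Q) = w P + w Q) (hk : 1 ≤ k) (hc2 : c * c = 1) (hwc : w c ≠ 0) :
    (arcType hw hk hc2 hwc 0).1 \ (arcType hw hk hc2 hwc 1).1 = univ.filter fun s => w s = 0 := by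
  ext s
  rw [mem_sdiff_arcType_one_iff, mem_filter]
  exact ⟨fun h => ⟨mem_univ _, h⟩, fun h => h.2⟩

/-- A bottom point lies in `T_0` and not in `T_1`. [folklore] -/
theorem mem_arcType_zero_and_notMem_one (hw : ∀ P Q : G, w (P * Q) = w P + w Q) (hk : 1 ≤ k) (hc2 : c * c = 1) (hwc : w c ≠ 0)
    {t : G} (ht : w t = 0) : t ∈ (arcType hw hk hc2 hwc 0).1 ∧ t ∉ (arcType hw hk hc2 hwc 1).1 :=
  mem_sdiff.mp ((mem_sdiff_arcType_one_iff hw hk hc2 hwc t).mpr ht)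

/-- **(W2) THE FIBRE SUM IS AN ARC COMBINATION modulo the bottom-walk faces**:
`Σ_{s ∈ F_0} [T_0^{(s)}] − [T_1] − (|F_0| − 1)·[T_0] ∈ ℤ⟨faces at types deviating from T_0 inside F_0⟩`. [folklore] -/
theorem fibreSum_sub_mem_span_walkFaces (hw : ∀ P Q : G, w (P * Q) = w P + w Q) (hk : 1 ≤ k) (hc2 : c * c = 1) (hwc : w c ≠ 0) :
    (∑ s ∈ univ.filter (fun s => w s = 0), Finsupp.single (oflipCM c hc2 s (arcType hw hk hc2 hwc 0)) (1 : ℤ)) -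
      Finsupp.single (arcType hw hk hc2 hwc 1) (1 : ℤ) -
        (((univ.filter fun s => w s = 0).card : ℤ) - 1) • Finsupp.single (arcType hw hk hc2 hwc 0) (1 : ℤ) ∈
      Submodule.span ℤ {y : CMF G c →₀ ℤ | ∃ (Φ' : CMF G c) (s s' : G),
        (arcType hw hk hc2 hwc 0).1 \ Φ'.1 ⊆ (univ.filter fun s => w s = 0) ∧ s ∈ (arcType hw hk hc2 hwc 0).1 \ Φ'.1 ∧
          s' ∈ (arcType hw hk hc2 hwc 0).1 \ Φ'.1 ∧ s ≠ s' ∧ y = gface c hc2 Φ' s s'} := by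
  have h := single_sub_normalForm_mem_span_local hc2 (arcType hw hk hc2 hwc 0) (univ.filter fun s => w s = 0)
    (arcType hw hk hc2 hwc 1) (by rw [sdiff_arcType_one])
  rw [sdiff_arcType_one, Finset.sum_sub_distrib, Finset.sum_const, ← Nat.cast_smul_eq_nsmul ℤ] at h
  have e : (∑ s ∈ univ.filter (fun s => w s = 0), Finsupp.single (oflipCM c hc2 s (arcType hw hk hc2 hwc 0)) (1 : ℤ)) -
      Finsupp.single (arcType hw hk hc2 hwc 1) (1 : ℤ) -
        (((univ.filter fun s => w s = 0).card : ℤ) - 1) • Finsupp.single (arcType hw hk hc2 hwc 0) (1 : ℤ) =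
      -(Finsupp.single (arcType hw hk hc2 hwc 1) (1 : ℤ) -
        ((∑ s ∈ univ.filter (fun s => w s = 0), Finsupp.single (oflipCM c hc2 s (arcType hw hk hc2 hwc 0)) (1 : ℤ)) -
          (((univ.filter fun s => w s = 0).card : ℤ)) • Finsupp.single (arcType hw hk hc2 hwc 0) (1 : ℤ) +
            Finsupp.single (arcType hw hk hc2 hwc 0) (1 : ℤ))) := by
    rw [sub_smul, one_smul]; abel
  rw [e]
  exact Submodule.neg_mem _ h

/-- **(W1) THE TOP FLIPS OF `T_1` ARE COMBINATIONS OF BOTTOM FLIPS OF `T_0` AND ARC TYPES modulo the bottom-walk faces**: for `w t = 0`,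
`[T_1^{(t)}] − [T_0] − Σ_{s ∈ F_0 ∖ t} ([T_0^{(s)}] − [T_0]) ∈ ℤ⟨faces at types deviating from T_0 inside F_0⟩`. [folklore] -/
theorem single_oflipCM_arcType_one_sub_mem_span_walkFaces (hw : ∀ P Q : G, w (P * Q) = w P + w Q) (hk : 1 ≤ k) (hc2 : c * c = 1)
    (hwc : w c ≠ 0) {t : G} (ht : w t = 0) :
    Finsupp.single (oflipCM c hc2 t (arcType hw hk hc2 hwc 1)) (1 : ℤ) -
      ((∑ s ∈ (univ.filter fun s => w s = 0).erase t,
        (Finsupp.single (oflipCM c hc2 s (arcType hw hk hc2 hwc 0)) (1 : ℤ) - Finsupp.single (arcType hw hk hc2 hwc 0) 1)) +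
          Finsupp.single (arcType hw hk hc2 hwc 0) 1) ∈
      Submodule.span ℤ {y : CMF G c →₀ ℤ | ∃ (Φ' : CMF G c) (s s' : G),
        (arcType hw hk hc2 hwc 0).1 \ Φ'.1 ⊆ (univ.filter fun s => w s = 0) ∧ s ∈ (arcType hw hk hc2 hwc 0).1 \ Φ'.1 ∧
          s' ∈ (arcType hw hk hc2 hwc 0).1 \ Φ'.1 ∧ s ≠ s' ∧ y = gface c hc2 Φ' s s'} := by
  obtain ⟨ht0, ht1⟩ := mem_arcType_zero_and_notMem_one hw hk hc2 hwc ht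
  have hdev : (arcType hw hk hc2 hwc 0).1 \ (oflipCM c hc2 t (arcType hw hk hc2 hwc 1)).1 = (univ.filter fun s => w s = 0).erase t := by
    rw [dev_oflip c hc2 ht0 ht1, sdiff_arcType_one]
  have h := single_sub_normalForm_mem_span_local hc2 (arcType hw hk hc2 hwc 0) (univ.filter fun s => w s = 0)
    (oflipCM c hc2 t (arcType hw hk hc2 hwc 1)) (by rw [hdev]; exact Finset.erase_subset _ _)
  rwa [hdev] at h

/-! ## §3 Consequences for the repaired hypotheses (fib) and (flip′) -/

/-- `[T] ∈ ℤ⟨base changes of T⟩`. [folklore] -/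
theorem single_mem_span_range_rt (T : CMF G c) :
    Finsupp.single T (1 : ℤ) ∈ Submodule.span ℤ (Set.range fun Q : G => Finsupp.single (rt c Q T) (1 : ℤ)) := by
  have h : Finsupp.single (rt c 1 T) (1 : ℤ) ∈ Submodule.span ℤ (Set.range fun Q : G => Finsupp.single (rt c Q T) (1 : ℤ)) :=
    Submodule.subset_span ⟨1, rfl⟩
  rwa [rt_one] at h

/-- **Re-indexing the fibre sum**: for `w s₀ = 0`, `Σ_{w Q = 0} [T_0^{(s₀)}·Q⁻¹] = Σ_{w s = 0} [T_0^{(s)}]`. [folklore] -/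
theorem fibreSum_rt_eq_sum_oflipCM (hw : ∀ P Q : G, w (P * Q) = w P + w Q) (hk : 1 ≤ k) (hc2 : c * c = 1) (hwc : w c ≠ 0) {s₀ : G}
    (hs₀ : w s₀ = 0) :
    (∑ Q ∈ univ.filter (fun Q => w Q = 0), Finsupp.single (rt c Q (oflipCM c hc2 s₀ (arcType hw hk hc2 hwc 0))) (1 : ℤ)) =
      ∑ s ∈ univ.filter (fun s => w s = 0), Finsupp.single (oflipCM c hc2 s (arcType hw hk hc2 hwc 0)) (1 : ℤ) := by
  refine Finset.sum_equiv ((Equiv.inv G).trans (Equiv.mulLeft s₀)) (fun Q => ?_) (fun Q hQ => ?_)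
  · simp only [mem_filter, mem_univ, true_and, Equiv.trans_apply, Equiv.inv_apply, Equiv.coe_mulLeft, hw, map_inv hw, hs₀, zero_add,
      neg_eq_zero]
  · have hQ0 : w Q = 0 := (mem_filter.mp hQ).2
    simp only [Equiv.trans_apply, Equiv.inv_apply, Equiv.coe_mulLeft]
    rw [rt_oflipCM, rt_arcType, hQ0, sub_zero]

/-- **(fib) FROM THE WALK RELATION (W2)**: if `L` contains the fibre-sum relation `Σ_{w s = 0} [T_0^{(s)}] − [T_1] − (|F_0| − 1)[T_0]` then the fibre sum
of the flip orbit of `T_0^{(s₀)}` (`w s₀ = 0`) lies in `L + ℤ⟨arc block⟩` — hypothesis `hfib₀` of parts XII/XIII with exponent `0` (`w` onto). [folklore] -/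
theorem fibreSum_mem_of_rel (hw : ∀ P Q : G, w (P * Q) = w P + w Q) (hk : 1 ≤ k) (hc2 : c * c = 1) (hwc : w c ≠ 0)
    (h1 : ∃ g₁ : G, w g₁ = 1) (L : Submodule ℤ (CMF G c →₀ ℤ))
    (hR2 : (∑ s ∈ univ.filter (fun s => w s = 0), Finsupp.single (oflipCM c hc2 s (arcType hw hk hc2 hwc 0)) (1 : ℤ)) -
      Finsupp.single (arcType hw hk hc2 hwc 1) (1 : ℤ) -
        (((univ.filter fun s => w s = 0).card : ℤ) - 1) • Finsupp.single (arcType hw hk hc2 hwc 0) (1 : ℤ) ∈ L)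
    {s₀ : G} (hs₀ : w s₀ = 0) :
    ((2 : ℤ) ^ 0) • (∑ Q ∈ univ.filter (fun Q => w Q = 0), Finsupp.single (rt c Q (oflipCM c hc2 s₀ (arcType hw hk hc2 hwc 0))) (1 : ℤ)) ∈
      L ⊔ Submodule.span ℤ (Set.range fun Q : G => Finsupp.single (rt c Q (arcType hw hk hc2 hwc 0)) (1 : ℤ)) := by
  rw [pow_zero, one_smul, fibreSum_rt_eq_sum_oflipCM hw hk hc2 hwc hs₀]
  obtain ⟨Q₁, hQ₁⟩ := exists_apply_eq hw h1 (-1)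
  have e : (∑ s ∈ univ.filter (fun s => w s = 0), Finsupp.single (oflipCM c hc2 s (arcType hw hk hc2 hwc 0)) (1 : ℤ)) =
      ((∑ s ∈ univ.filter (fun s => w s = 0), Finsupp.single (oflipCM c hc2 s (arcType hw hk hc2 hwc 0)) (1 : ℤ)) -
      Finsupp.single (arcType hw hk hc2 hwc 1) (1 : ℤ) -
        (((univ.filter fun s => w s = 0).card : ℤ) - 1) • Finsupp.single (arcType hw hk hc2 hwc 0) (1 : ℤ)) +
        (Finsupp.single (arcType hw hk hc2 hwc 1) (1 : ℤ) +
          (((univ.filter fun s => w s = 0).card : ℤ) - 1) • Finsupp.single (arcType hw hk hc2 hwc 0) (1 : ℤ)) := by abel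
  rw [e]
  refine Submodule.add_mem _ (Submodule.mem_sup_left hR2) (Submodule.mem_sup_right (Submodule.add_mem _ ?_ (Submodule.smul_mem _ _ ?_)))
  · rw [arcType_eq_rt hw hk hc2 hwc hQ₁]
    exact Submodule.subset_span ⟨Q₁, rfl⟩
  · exact single_mem_span_range_rt _

/-- **(fib) FROM THE WALK**: if `L` contains the bottom-walk faces then `hfib₀` holds with exponent `0`. [folklore] -/
theorem fibreSum_mem_of_walkFaces_le (hw : ∀ P Q : G, w (P * Q) = w P + w Q) (hk : 1 ≤ k) (hc2 : c * c = 1) (hwc : w c ≠ 0)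
    (h1 : ∃ g₁ : G, w g₁ = 1) (L : Submodule ℤ (CMF G c →₀ ℤ))
    (hW : Submodule.span ℤ {y : CMF G c →₀ ℤ | ∃ (Φ' : CMF G c) (s s' : G),
        (arcType hw hk hc2 hwc 0).1 \ Φ'.1 ⊆ (univ.filter fun s => w s = 0) ∧ s ∈ (arcType hw hk hc2 hwc 0).1 \ Φ'.1 ∧
          s' ∈ (arcType hw hk hc2 hwc 0).1 \ Φ'.1 ∧ s ≠ s' ∧ y = gface c hc2 Φ' s s'} ≤ L)
    {s₀ : G} (hs₀ : w s₀ = 0) :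
    ((2 : ℤ) ^ 0) • (∑ Q ∈ univ.filter (fun Q => w Q = 0), Finsupp.single (rt c Q (oflipCM c hc2 s₀ (arcType hw hk hc2 hwc 0))) (1 : ℤ)) ∈
      L ⊔ Submodule.span ℤ (Set.range fun Q : G => Finsupp.single (rt c Q (arcType hw hk hc2 hwc 0)) (1 : ℤ)) :=
  fibreSum_mem_of_rel hw hk hc2 hwc h1 L (hW (fibreSum_sub_mem_span_walkFaces hw hk hc2 hwc)) hs₀

/-- **(flip′) FOR A TOP FLIP OF `T_1` FROM THE WALK RELATION (W1)**: if `L` contains `[T_1^{(t)}] − [T_0] − Σ_{s ∈ F_0 ∖ t} ([T_0^{(s)}] − [T_0])`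
(`w t = 0`) then `[T_1^{(t)}]` lies in `(L + ℤ⟨arc block⟩) + ℤ⟨flip orbit of T_0^{(s₀)}⟩` (`w s₀ = 0`). [folklore] -/
theorem single_oflipCM_arcType_one_mem_of_rel (hw : ∀ P Q : G, w (P * Q) = w P + w Q) (hk : 1 ≤ k) (hc2 : c * c = 1)
    (hwc : w c ≠ 0) (L : Submodule ℤ (CMF G c →₀ ℤ)) {s₀ t : G} (hs₀ : w s₀ = 0)
    (hR1 : Finsupp.single (oflipCM c hc2 t (arcType hw hk hc2 hwc 1)) (1 : ℤ) -
      ((∑ s ∈ (univ.filter fun s => w s = 0).erase t,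
        (Finsupp.single (oflipCM c hc2 s (arcType hw hk hc2 hwc 0)) (1 : ℤ) - Finsupp.single (arcType hw hk hc2 hwc 0) 1)) +
          Finsupp.single (arcType hw hk hc2 hwc 0) 1) ∈ L) :
    Finsupp.single (oflipCM c hc2 t (arcType hw hk hc2 hwc 1)) (1 : ℤ) ∈
      (L ⊔ Submodule.span ℤ (Set.range fun Q : G => Finsupp.single (rt c Q (arcType hw hk hc2 hwc 0)) (1 : ℤ))) ⊔
        Submodule.span ℤ (Set.range fun Q : G => Finsupp.single (rt c Q (oflipCM c hc2 s₀ (arcType hw hk hc2 hwc 0))) (1 : ℤ)) := by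
  rw [← sub_add_cancel (Finsupp.single (oflipCM c hc2 t (arcType hw hk hc2 hwc 1)) (1 : ℤ))
    ((∑ s ∈ (univ.filter fun s => w s = 0).erase t,
        (Finsupp.single (oflipCM c hc2 s (arcType hw hk hc2 hwc 0)) (1 : ℤ) - Finsupp.single (arcType hw hk hc2 hwc 0) 1)) +
          Finsupp.single (arcType hw hk hc2 hwc 0) 1)]
  have hT0 : Finsupp.single (arcType hw hk hc2 hwc 0) (1 : ℤ) ∈
      (L ⊔ Submodule.span ℤ (Set.range fun Q : G => Finsupp.single (rt c Q (arcType hw hk hc2 hwc 0)) (1 : ℤ))) ⊔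
        Submodule.span ℤ (Set.range fun Q : G => Finsupp.single (rt c Q (oflipCM c hc2 s₀ (arcType hw hk hc2 hwc 0))) (1 : ℤ)) :=
    Submodule.mem_sup_left (Submodule.mem_sup_right (single_mem_span_range_rt _))
  refine Submodule.add_mem _ (Submodule.mem_sup_left (Submodule.mem_sup_left hR1)) (Submodule.add_mem _ (Submodule.sum_mem _ fun s hs => ?_) hT0)
  refine Submodule.sub_mem _ ?_ hT0
  rw [oflipCM_arcType_eq_rt_of_apply_eq hw hk hc2 hwc (((mem_filter.mp (Finset.mem_of_mem_erase hs)).2).trans hs₀.symm)]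
  exact Submodule.mem_sup_right (Submodule.subset_span ⟨s⁻¹ * s₀, rfl⟩)

/-- **(flip′) FOR THE TOP FLIPS OF `T_1` FROM THE WALK**: if `L` contains the bottom-walk faces, `w t = 0` and `w s₀ = 0`, then `[T_1^{(t)}]` lies in
`(L + ℤ⟨arc block⟩) + ℤ⟨flip orbit of T_0^{(s₀)}⟩`. [folklore] -/
theorem single_oflipCM_arcType_one_mem_of_walkFaces_le (hw : ∀ P Q : G, w (P * Q) = w P + w Q) (hk : 1 ≤ k) (hc2 : c * c = 1)
    (hwc : w c ≠ 0) (L : Submodule ℤ (CMF G c →₀ ℤ))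
    (hW : Submodule.span ℤ {y : CMF G c →₀ ℤ | ∃ (Φ' : CMF G c) (s s' : G),
        (arcType hw hk hc2 hwc 0).1 \ Φ'.1 ⊆ (univ.filter fun s => w s = 0) ∧ s ∈ (arcType hw hk hc2 hwc 0).1 \ Φ'.1 ∧
          s' ∈ (arcType hw hk hc2 hwc 0).1 \ Φ'.1 ∧ s ≠ s' ∧ y = gface c hc2 Φ' s s'} ≤ L)
    {s₀ t : G} (hs₀ : w s₀ = 0) (ht : w t = 0) :
    Finsupp.single (oflipCM c hc2 t (arcType hw hk hc2 hwc 1)) (1 : ℤ) ∈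
      (L ⊔ Submodule.span ℤ (Set.range fun Q : G => Finsupp.single (rt c Q (arcType hw hk hc2 hwc 0)) (1 : ℤ))) ⊔
        Submodule.span ℤ (Set.range fun Q : G => Finsupp.single (rt c Q (oflipCM c hc2 s₀ (arcType hw hk hc2 hwc 0))) (1 : ℤ)) :=
  single_oflipCM_arcType_one_mem_of_rel hw hk hc2 hwc L hs₀ (hW (single_oflipCM_arcType_one_sub_mem_span_walkFaces hw hk hc2 hwc ht))

omit [Fintype G] [DecidableEq G] in
/-- `2ᵏ⁻¹ + 2ᵏ⁻¹ = 0` in `ℤ/2ᵏ` (`k ≥ 1`). [folklore] -/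
theorem half_add_half (hk : 1 ≤ k) : ((2 ^ (k - 1) : ℕ) : ZMod (2 ^ k)) + ((2 ^ (k - 1) : ℕ) : ZMod (2 ^ k)) = 0 := by
  have h2k : 2 ^ k = 2 * 2 ^ (k - 1) := by rw [← pow_succ', Nat.sub_add_cancel hk]
  rw [← Nat.cast_add, ← two_mul, ← h2k, ZMod.natCast_self]

/-- **(flip′) FOR THE TOP FLIPS OF `T_0` FROM THE WALK RELATIONS (W1)**: if `ℤ⟨pairs⟩ + ℤ[G]·S` contains the relations
`[T_1^{(t)}] − [T_0] − Σ_{s ∈ F_0 ∖ t} ([T_0^{(s)}] − [T_0])` for all `t` with `w t = 0`, then every single flip `T_0^{(s)}` at the TOP fibre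
(`w s = 2ᵏ⁻¹ − 1`) lies in the repaired target `𝓣(S)` of part XII (flip orbit of `T_0^{(s₀)}`, `w s₀ = 0`; `w` onto, `c` central). [folklore] -/
theorem single_oflipCM_top_mem_flipTarget_of_rel (hw : ∀ P Q : G, w (P * Q) = w P + w Q) (hk : 1 ≤ k) (hc2 : c * c = 1)
    (hcen : ∀ x : G, x * c = c * x) (hwc : w c ≠ 0) (h1 : ∃ g₁ : G, w g₁ = 1) (S : Finset (CMF G c →₀ ℤ))
    (hR1 : ∀ t : G, w t = 0 → Finsupp.single (oflipCM c hc2 t (arcType hw hk hc2 hwc 1)) (1 : ℤ) -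
      ((∑ s ∈ (univ.filter fun s => w s = 0).erase t,
        (Finsupp.single (oflipCM c hc2 s (arcType hw hk hc2 hwc 0)) (1 : ℤ) - Finsupp.single (arcType hw hk hc2 hwc 0) 1)) +
          Finsupp.single (arcType hw hk hc2 hwc 0) 1) ∈ Submodule.span ℤ (pairSet c) ⊔ Submodule.span ℤ (translates c S))
    {s₀ s : G} (hs₀ : w s₀ = 0) (hs : w s = ((2 ^ (k - 1) : ℕ) : ZMod (2 ^ k)) - 1) :
    Finsupp.single (oflipCM c hc2 s (arcType hw hk hc2 hwc 0)) (1 : ℤ) ∈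
      ((Submodule.span ℤ (pairSet c) ⊔ Submodule.span ℤ (translates c S)) ⊔
        Submodule.span ℤ (Set.range fun Q : G => Finsupp.single (rt c Q (arcType hw hk hc2 hwc 0)) (1 : ℤ))) ⊔
          Submodule.span ℤ (Set.range fun Q : G => Finsupp.single (rt c Q (oflipCM c hc2 s₀ (arcType hw hk hc2 hwc 0))) (1 : ℤ)) := by
  obtain ⟨Q, hQ⟩ := h1
  have ht : w (c * s * Q) = 0 := by
    rw [hw, hw, apply_c hw hk hc2 hwc, hs, hQ, ← add_sub_assoc, half_add_half hk, zero_sub, neg_add_cancel]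
  have e : oflipCM c hc2 s (arcType hw hk hc2 hwc 0) = rt c Q (oflipCM c hc2 (c * s * Q) (arcType hw hk hc2 hwc 1)) := by
    rw [rt_oflipCM, rt_arcType, hQ, sub_self, mul_inv_cancel_right, oflipCM_cmul]
  rw [e, ← Finsupp.mapDomain_single]
  exact mapDomain_rt_mem_flipTarget hcen S _ _ Q (single_oflipCM_arcType_one_mem_of_rel hw hk hc2 hwc _ hs₀ (hR1 _ ht))

/-- **(flip′) FOR THE TOP FLIPS OF `T_0` FROM THE WALK**: the same when `ℤ⟨pairs⟩ + ℤ[G]·S` contains all the bottom-walk faces. [folklore] -/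
theorem single_oflipCM_top_mem_flipTarget_of_walkFaces_le (hw : ∀ P Q : G, w (P * Q) = w P + w Q) (hk : 1 ≤ k) (hc2 : c * c = 1)
    (hcen : ∀ x : G, x * c = c * x) (hwc : w c ≠ 0) (h1 : ∃ g₁ : G, w g₁ = 1) (S : Finset (CMF G c →₀ ℤ))
    (hW : Submodule.span ℤ {y : CMF G c →₀ ℤ | ∃ (Φ' : CMF G c) (s s' : G),
        (arcType hw hk hc2 hwc 0).1 \ Φ'.1 ⊆ (univ.filter fun s => w s = 0) ∧ s ∈ (arcType hw hk hc2 hwc 0).1 \ Φ'.1 ∧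
          s' ∈ (arcType hw hk hc2 hwc 0).1 \ Φ'.1 ∧ s ≠ s' ∧ y = gface c hc2 Φ' s s'} ≤
        Submodule.span ℤ (pairSet c) ⊔ Submodule.span ℤ (translates c S))
    {s₀ s : G} (hs₀ : w s₀ = 0) (hs : w s = ((2 ^ (k - 1) : ℕ) : ZMod (2 ^ k)) - 1) :
    Finsupp.single (oflipCM c hc2 s (arcType hw hk hc2 hwc 0)) (1 : ℤ) ∈
      ((Submodule.span ℤ (pairSet c) ⊔ Submodule.span ℤ (translates c S)) ⊔
        Submodule.span ℤ (Set.range fun Q : G => Finsupp.single (rt c Q (arcType hw hk hc2 hwc 0)) (1 : ℤ))) ⊔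
          Submodule.span ℤ (Set.range fun Q : G => Finsupp.single (rt c Q (oflipCM c hc2 s₀ (arcType hw hk hc2 hwc 0))) (1 : ℤ)) :=
  single_oflipCM_top_mem_flipTarget_of_rel hw hk hc2 hcen hwc h1 S
    (fun _ ht => hW (single_oflipCM_arcType_one_sub_mem_span_walkFaces hw hk hc2 hwc ht)) hs₀ hs

end

end Summit.HodgeConjecture.CorCM.Census.CyclicCharacter
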